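import Summits.CriticalPhenomena.PercolationContinuityZ3.Theorems.PercNearOneGluingNoHeavyLowerTailKnQuestion8CoefficientwiseRemBookClusters
import HarnessLib

/-!
# (REM) for ALL target sets on the book graphs — the residual matching of THEOREM θ in its first instance (part 2) — prim-lf-2 gen 68

Support file (`--supports stmt-CriticalPhenomena-4575`, closed), prover `prim-lf-2` (gen 68).  No definitions, no named facts, no sorries; standard axioms.
Memo `prim-lf-2/CW-SUBROWS-gen68.md` §8, §9, §11 (Target 1); part 1 = `…CoefficientwiseRemBookClusters.lean` (clusters of the root on a book graph, the map `ψ`).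

The BOOK GRAPH `B_k`: root `x`, pole `h`, leaves `ℓ_i` (`i : Fin k`), edges `ea i = {x, ℓ_i}`, `eb i = {ℓ_i, h}` and the spine `e = {x, h}`.  CONJECTURE (REM) (prim-lf-2 gen 66):
`REM_E(e; x, W)[g] := Σ_{s ⊆ E : e ∈ s, ∀ w∈W ¬(w ∈ C_x s ∧ w ∈ C_x(E∖s))} (g(C_x s) − g(C_x(E∖s))) ≥ 0`.
* `Coefficientwise.rem_nonneg_book` — **THEOREM**: `REM_E(e;x,W)[g] ≥ 0` on every book graph, for every `k`, every target set `W` and every monotone `g` (root of degree `k+1`, on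
  cycles of `E∖e`: not covered by `rem_nonneg_of_rootDegTwo` / `rootOffCycles` / `single_target` / `bridge`).  PROOF = the explicit Strassen coupling of memo §8–§9: `Φ s = insert e (E∖s)`
  dominates (`C_x(E∖s) ⊆ C_x(Φ s)`) and is used whenever `Φ s` stays in the event; on the residual (`Φ s` leaves the event) one shows that no leaf has both edges blue, so
  `C_x(E∖s) ⊆ {x} ∪ {ℓ_i : ea i ∉ s}` is dominated by `C_x(ψ s)`, and `ψ` is an involution of the residual; `Π = Φ or ψ` is a bijection of the event with `C_x(E∖s) ⊆ C_x(Π s)`,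
  hence `Σ_{Ev} g(C_x s) = Σ_{Ev} g(C_x(Π s)) ≥ Σ_{Ev} g(C_x(E∖s))`.
[cite: KozmaNitzan2024, Questions 8–9 (§5.5 p. 36) (context: the Question-8 pocket covariance programme)]
-/

namespace Summit.CriticalPhenomena.PercolationContinuityZ3.Theorems

open Finset Literature.Probability.Percolation

namespace Coefficientwise

variable {ι V : Type*}

section Book

variable (ends : ι → Sym2 V) {k : ℕ} (x h : V) (lf : Fin k → V) (ea eb : Fin k → ι) (e : ι) (E : Finset ι)
variable (hxh : x ≠ h) (hlx : ∀ i, lf i ≠ x) (hlh : ∀ i, lf i ≠ h) (hlf : Function.Injective lf)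
variable (hends_e : ends e = s(x, h)) (hends_a : ∀ i, ends (ea i) = s(x, lf i)) (hends_b : ∀ i, ends (eb i) = s(lf i, h))
variable (hE : ∀ j, j ∈ E ↔ j = e ∨ (∃ i, j = ea i) ∨ (∃ i, j = eb i))
variable [DecidableEq ι] (W : Set V)

/-! ### The theorem -/

open Classical in
include hxh hlx hlh hlf hends_e hends_a hends_b hE in
/-- **(REM) on every book graph, for every target set.**  With the notation of this section (`E` = spine `e = {x,h}` plus the `2k` leaf edges), for every `W : Set V` and
every monotone `g`:  `0 ≤ Σ_{s ⊆ E : e ∈ s, ∀ w∈W ¬(w ∈ C_x s ∧ w ∈ C_x(E∖s))} (g(C_x s) − g(C_x(E∖s)))`.  [cite: KozmaNitzan2024, Questions 8–9 (§5.5 p. 36) (context)] -/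
theorem rem_nonneg_book (g : Set V → ℝ) (hg : Monotone g) :
    0 ≤ ∑ s ∈ E.powerset.filter (fun s : Finset ι => e ∈ s ∧
          ∀ w ∈ W, ¬ (w ∈ openCluster (ends '' (↑s : Set ι)) x ∧ w ∈ openCluster (ends '' (↑(E \ s) : Set ι)) x)),
      (g (openCluster (ends '' (↑s : Set ι)) x) - g (openCluster (ends '' (↑(E \ s) : Set ι)) x)) := by
  set K : Finset ι → Set V := fun t => openCluster (ends '' (↑t : Set ι)) x with hK
  obtain ⟨hae, hbe, hab, hainj, hbinj⟩ := book_edges_distinct ends x h lf ea eb e hxh hlx hlh hlf hends_e hends_a hends_b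
  have heE : e ∈ E := (hE e).mpr (Or.inl rfl)
  have haE : ∀ i, ea i ∈ E := fun i => (hE _).mpr (Or.inr (Or.inl ⟨i, rfl⟩))
  have hbE : ∀ i, eb i ∈ E := fun i => (hE _).mpr (Or.inr (Or.inr ⟨i, rfl⟩))
  -- cluster facts
  have hpole := fun (t : Finset ι) (ht : t ⊆ E) =>
    book_mem_openCluster_iff_pole ends x h lf ea eb e E hxh hlx hlh hlf hends_e hends_a hends_b hE t ht
  have hleaf := fun (t : Finset ι) (ht : t ⊆ E) (i : Fin k) =>
    book_mem_openCluster_iff_leaf ends x h lf ea eb e E hxh hlx hlh hlf hends_e hends_a hends_b hE t ht i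
  have hcases := fun (t : Finset ι) (ht : t ⊆ E) (v : V) (hv : v ∈ openCluster (ends '' (↑t : Set ι)) x) =>
    book_openCluster_cases ends x h lf ea eb e E hxh hlx hlh hlf hends_e hends_a hends_b hE t ht hv
  have hxW_of_Ev : ∀ t : Finset ι, (∀ w ∈ W, ¬ (w ∈ K t ∧ w ∈ K (E \ t))) → x ∉ W :=
    fun t ht hxW => ht x hxW ⟨mem_openCluster_self _ x, mem_openCluster_self _ x⟩
  -- the flip `Φ`
  have hPhi_sub : ∀ t : Finset ι, insert e (E \ t) ⊆ E := fun t => Finset.insert_subset heE Finset.sdiff_subset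
  have hPhi_compl : ∀ t : Finset ι, t ⊆ E → E \ insert e (E \ t) = t.erase e := by
    intro t ht; ext j
    simp only [Finset.mem_sdiff, Finset.mem_insert, Finset.mem_erase, not_or, not_and, not_not]
    constructor
    · rintro ⟨hjE, hje, hj⟩; exact ⟨hje, hj hjE⟩
    · rintro ⟨hje, hjt⟩; exact ⟨ht hjt, hje, fun _ => hjt⟩
  have hPhi_Phi : ∀ t : Finset ι, t ⊆ E → e ∈ t → insert e (E \ insert e (E \ t)) = t := by
    intro t ht het; rw [hPhi_compl t ht, Finset.insert_erase het]
  -- ψ facts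
  have hpsi := book_mem_psi ends x h lf ea eb e hxh hlx hlh hlf hends_e hends_a hends_b W
  have hpsi_sub := book_psi_subset lf ea eb e E hE W
  -- MAIN CLAIM: a dominating involution `Pm` of the event
  set F : Finset (Finset ι) := E.powerset.filter (fun s : Finset ι => e ∈ s ∧ ∀ w ∈ W, ¬ (w ∈ K s ∧ w ∈ K (E \ s))) with hF
  set Pm : Finset ι → Finset ι := fun s =>
    if (∀ w ∈ W, ¬ (w ∈ K (insert e (E \ s)) ∧ w ∈ K (E \ insert e (E \ s)))) then insert e (E \ s) else bookPsi lf ea eb e W s with hPm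
  have hmemF : ∀ t : Finset ι, t ∈ F ↔ (t ⊆ E ∧ e ∈ t ∧ ∀ w ∈ W, ¬ (w ∈ K t ∧ w ∈ K (E \ t))) := by
    intro t; simp only [hF, Finset.mem_filter, Finset.mem_powerset]
  -- membership helpers
  have haPhi : ∀ (t : Finset ι) i, ea i ∈ insert e (E \ t) ↔ ea i ∉ t := fun t i => by
    rw [Finset.mem_insert, Finset.mem_sdiff]; exact ⟨fun h => h.elim (fun h1 => absurd h1 (hae i)) (fun h2 => h2.2), fun h => Or.inr ⟨haE i, h⟩⟩
  have hbPhi : ∀ (t : Finset ι) i, eb i ∈ insert e (E \ t) ↔ eb i ∉ t := fun t i => by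
    rw [Finset.mem_insert, Finset.mem_sdiff]; exact ⟨fun h => h.elim (fun h1 => absurd h1 (hbe i)) (fun h2 => h2.2), fun h => Or.inr ⟨hbE i, h⟩⟩
  have haSd : ∀ (t : Finset ι) i, ea i ∈ E \ t ↔ ea i ∉ t := fun t i => by
    rw [Finset.mem_sdiff]; exact ⟨fun h => h.2, fun h => ⟨haE i, h⟩⟩
  have hbSd : ∀ (t : Finset ι) i, eb i ∈ E \ t ↔ eb i ∉ t := fun t i => by
    rw [Finset.mem_sdiff]; exact ⟨fun h => h.2, fun h => ⟨hbE i, h⟩⟩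
  have haEr : ∀ (t : Finset ι) i, ea i ∈ t.erase e ↔ ea i ∈ t := fun t i => by
    rw [Finset.mem_erase]; exact ⟨fun h => h.2, fun h => ⟨hae i, h⟩⟩
  have hbEr : ∀ (t : Finset ι) i, eb i ∈ t.erase e ↔ eb i ∈ t := fun t i => by
    rw [Finset.mem_erase]; exact ⟨fun h => h.2, fun h => ⟨hbe i, h⟩⟩
  -- specialised cluster memberships for `t` with `e ∈ t ⊆ E`
  have Kleaf : ∀ t : Finset ι, t ⊆ E → e ∈ t → ∀ i, (lf i ∈ K t ↔ ea i ∈ t ∨ eb i ∈ t) := by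
    intro t ht het i; rw [hleaf t ht i]
    exact ⟨fun hh => hh.elim Or.inl (fun h2 => Or.inr h2.1), fun hh => hh.elim Or.inl (fun h2 => Or.inr ⟨h2, Or.inl het⟩)⟩
  have Kpole : ∀ t : Finset ι, t ⊆ E → e ∈ t → h ∈ K t := fun t ht het => (hpole t ht).mpr (Or.inl het)
  have Bpole : ∀ t : Finset ι, t ⊆ E → e ∈ t → (h ∈ K (E \ t) ↔ ∃ j, ea j ∉ t ∧ eb j ∉ t) := by
    intro t ht het; rw [hpole (E \ t) Finset.sdiff_subset]; simp only [haSd, hbSd]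
    exact ⟨fun hh => hh.elim (fun h1 => absurd (Finset.mem_sdiff.mp h1).2 (not_not.mpr het)) id, Or.inr⟩
  have Bleaf : ∀ t : Finset ι, t ⊆ E → e ∈ t → ∀ i, (lf i ∈ K (E \ t) ↔ ea i ∉ t ∨ (eb i ∉ t ∧ ∃ j, ea j ∉ t ∧ eb j ∉ t)) := by
    intro t ht het i; rw [hleaf (E \ t) Finset.sdiff_subset i]; simp only [haSd, hbSd]
    have hne : e ∉ E \ t := fun h1 => (Finset.mem_sdiff.mp h1).2 het
    exact ⟨fun hh => hh.elim Or.inl (fun h2 => Or.inr ⟨h2.1, h2.2.elim (fun h3 => absurd h3 hne) id⟩),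
      fun hh => hh.elim Or.inl (fun h2 => Or.inr ⟨h2.1, Or.inr h2.2⟩)⟩
  have PhiKleaf : ∀ t : Finset ι, t ⊆ E → ∀ i, (lf i ∈ K (insert e (E \ t)) ↔ ea i ∉ t ∨ eb i ∉ t) := by
    intro t ht i; rw [Kleaf _ (hPhi_sub t) (Finset.mem_insert_self _ _) i, haPhi, hbPhi]
  have PhiBpole : ∀ t : Finset ι, t ⊆ E → (h ∈ K (t.erase e) ↔ ∃ j, ea j ∈ t ∧ eb j ∈ t) := by
    intro t ht; rw [hpole _ ((Finset.erase_subset e t).trans ht)]; simp only [haEr, hbEr]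
    exact ⟨fun hh => hh.elim (fun h1 => absurd h1 (Finset.notMem_erase e t)) id, Or.inr⟩
  have PhiBleaf : ∀ t : Finset ι, t ⊆ E → ∀ i, (lf i ∈ K (t.erase e) ↔ ea i ∈ t ∨ (eb i ∈ t ∧ ∃ j, ea j ∈ t ∧ eb j ∈ t)) := by
    intro t ht i; rw [hleaf _ ((Finset.erase_subset e t).trans ht) i]; simp only [haEr, hbEr]
    exact ⟨fun hh => hh.elim Or.inl (fun h2 => Or.inr ⟨h2.1, h2.2.elim (fun h3 => absurd h3 (Finset.notMem_erase e t)) id⟩),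
      fun hh => hh.elim Or.inl (fun h2 => Or.inr ⟨h2.1, Or.inr h2.2⟩)⟩
  -- Case-B analysis: for `s` in the event with `Φ s` outside the event
  have caseB : ∀ s : Finset ι, s ⊆ E → e ∈ s → (∀ w ∈ W, ¬ (w ∈ K s ∧ w ∈ K (E \ s))) →
      ¬ (∀ w ∈ W, ¬ (w ∈ K (insert e (E \ s)) ∧ w ∈ K (E \ insert e (E \ s)))) →
      ( (∀ i, ea i ∈ s ∨ eb i ∈ s) ∧ (∀ i, lf i ∈ W → ea i ∈ s) ∧
        ((h ∈ W ∧ ∃ j, ea j ∈ s ∧ eb j ∈ s) ∨ (∃ i, lf i ∈ W ∧ ea i ∈ s ∧ eb i ∉ s)) ) := by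
    intro s hs hes hEv hnPhi
    have hxW := hxW_of_Ev s hEv
    rw [hPhi_compl s hs] at hnPhi
    have step1 : ∀ i, ea i ∈ s ∨ eb i ∈ s := by
      by_contra hcon
      push Not at hcon
      obtain ⟨i0, hi0a, hi0b⟩ := hcon
      apply hnPhi
      intro w hw hwKB
      obtain ⟨hwK, hwB⟩ := hwKB
      rcases hcases _ (hPhi_sub s) w hwK with hw1 | hw2 | ⟨i, hw3⟩
      · exact hxW (hw1 ▸ hw)
      · rw [hw2] at hw
        exact hEv h hw ⟨Kpole s hs hes, (Bpole s hs hes).mpr ⟨i0, hi0a, hi0b⟩⟩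
      · rw [hw3] at hw hwK hwB
        rw [PhiKleaf s hs i] at hwK
        rw [PhiBleaf s hs i] at hwB
        apply hEv (lf i) hw
        refine ⟨(Kleaf s hs hes i).mpr (hwB.elim Or.inl (fun h2 => Or.inr h2.1)), (Bleaf s hs hes i).mpr ?_⟩
        rcases hwK with hna | hnb
        · exact Or.inl hna
        · rcases hwB with hai | ⟨hbi, _⟩
          · exact Or.inr ⟨hnb, i0, hi0a, hi0b⟩
          · exact absurd hbi hnb
    have step2 : ∀ i, lf i ∈ W → ea i ∈ s := by
      intro i hiW
      rcases step1 i with hai | hbi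
      · exact hai
      · by_contra hai
        exact hEv (lf i) hiW ⟨(Kleaf s hs hes i).mpr (Or.inr hbi), (Bleaf s hs hes i).mpr (Or.inl hai)⟩
    refine ⟨step1, step2, ?_⟩
    by_contra hnone
    push Not at hnone
    apply hnPhi
    intro w hw hwKB
    obtain ⟨hwK, hwB⟩ := hwKB
    rcases hcases _ (hPhi_sub s) w hwK with hw1 | hw2 | ⟨i, hw3⟩
    · exact hxW (hw1 ▸ hw)
    · rw [hw2] at hw hwB
      obtain ⟨j, hja, hjb⟩ := (PhiBpole s hs).mp hwB
      exact hnone.1 hw j hja hjb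
    · rw [hw3] at hw hwK
      have hai : ea i ∈ s := step2 i hw
      rcases (PhiKleaf s hs i).mp hwK with hna | hnb
      · exact hna hai
      · exact hnb (hnone.2 i hw hai)
  -- the effect of ψ on each leaf, under the Case-B conditions
  have psiEff : ∀ s : Finset ι, (∀ i, ea i ∈ s ∨ eb i ∈ s) → (∀ i, lf i ∈ W → ea i ∈ s) → ∀ i,
      (ea i ∈ s → eb i ∈ s → (ea i ∈ bookPsi lf ea eb e W s ∧ eb i ∈ bookPsi lf ea eb e W s)) ∧
      (ea i ∈ s → eb i ∉ s → lf i ∈ W → (ea i ∈ bookPsi lf ea eb e W s ∧ eb i ∉ bookPsi lf ea eb e W s)) ∧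
      (ea i ∈ s → eb i ∉ s → lf i ∉ W → (ea i ∉ bookPsi lf ea eb e W s ∧ eb i ∈ bookPsi lf ea eb e W s)) ∧
      (ea i ∉ s → eb i ∈ s → (ea i ∈ bookPsi lf ea eb e W s ∧ eb i ∉ bookPsi lf ea eb e W s)) := by
    intro s h1 h2 i
    have eA := (hpsi s).2.1 i
    have eB := (hpsi s).2.2 i
    simp only [bookNewA, bookNewB, bookKeep] at eA eB
    refine ⟨fun ha hb => ?_, fun ha hb hw => ?_, fun ha hb hw => ?_, fun ha hb => ?_⟩
    · rw [eA, eB]; constructor <;> · left; exact ⟨Or.inl (by simp [ha, hb]), by assumption⟩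
    · rw [eA, eB]; constructor
      · left; exact ⟨Or.inr ⟨ha, hb, hw⟩, ha⟩
      · rintro (⟨_, hb'⟩ | ⟨hk, _⟩)
        · exact hb hb'
        · exact hk (Or.inr ⟨ha, hb, hw⟩)
    · have hk : ¬ ((ea i ∈ s ↔ eb i ∈ s) ∨ (ea i ∈ s ∧ eb i ∉ s ∧ lf i ∈ W)) := by
        rintro (h3 | ⟨_, _, h3⟩)
        · exact hb (h3.mp ha)
        · exact hw h3
      rw [eA, eB]; constructor
      · rintro (⟨h3, _⟩ | ⟨_, hb'⟩)
        · exact hk h3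
        · exact hb hb'
      · right; exact ⟨hk, ha⟩
    · have hw : lf i ∉ W := fun hw => ha (h2 i hw)
      have hk : ¬ ((ea i ∈ s ↔ eb i ∈ s) ∨ (ea i ∈ s ∧ eb i ∉ s ∧ lf i ∈ W)) := by
        rintro (h3 | ⟨h3, _, _⟩)
        · exact ha (h3.mpr hb)
        · exact ha h3
      rw [eA, eB]; constructor
      · right; exact ⟨hk, hb⟩
      · rintro (⟨h3, _⟩ | ⟨_, ha'⟩)
        · exact hk h3
        · exact ha ha'
  -- properties of `Pm` on `F`
  have hPm_props : ∀ s ∈ F, Pm s ∈ F ∧ Pm (Pm s) = s ∧ K (E \ s) ⊆ K (Pm s) := by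
    intro s hsF
    obtain ⟨hs, hes, hEv⟩ := (hmemF s).mp hsF
    by_cases hA : ∀ w ∈ W, ¬ (w ∈ K (insert e (E \ s)) ∧ w ∈ K (E \ insert e (E \ s)))
    · -- Case A: Pm s = Φ s
      have hPms : Pm s = insert e (E \ s) := by simp only [hPm, if_pos hA]
      refine ⟨?_, ?_, ?_⟩
      · rw [hPms, hmemF]; exact ⟨hPhi_sub s, Finset.mem_insert_self _ _, hA⟩
      · rw [hPms]
        have hA' : ∀ w ∈ W, ¬ (w ∈ K (insert e (E \ insert e (E \ s))) ∧ w ∈ K (E \ insert e (E \ insert e (E \ s)))) := by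
          rw [hPhi_Phi s hs hes]; exact hEv
        simp only [hPm, if_pos hA', hPhi_Phi s hs hes]
      · rw [hPms]; exact openCluster_image_mono ends (Finset.subset_insert e (E \ s)) x
    · -- Case B: Pm s = ψ s
      have hPms : Pm s = bookPsi lf ea eb e W s := by simp only [hPm, if_neg hA]
      obtain ⟨step1, step2, wit⟩ := caseB s hs hes hEv hA
      have hxW := hxW_of_Ev s hEv
      set s' := bookPsi lf ea eb e W s with hs'
      have hs'E : s' ⊆ E := hpsi_sub s
      have hes' : e ∈ s' := (hpsi s).1
      have eff := psiEff s step1 step2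
      -- leaf states of s'
      have step1' : ∀ i, ea i ∈ s' ∨ eb i ∈ s' := by
        intro i
        by_cases ha : ea i ∈ s
        · by_cases hb : eb i ∈ s
          · exact Or.inl ((eff i).1 ha hb).1
          · by_cases hw : lf i ∈ W
            · exact Or.inl ((eff i).2.1 ha hb hw).1
            · exact Or.inr ((eff i).2.2.1 ha hb hw).2
        · exact Or.inl ((eff i).2.2.2 ha ((step1 i).resolve_left ha)).1
      have step2' : ∀ i, lf i ∈ W → ea i ∈ s' := by
        intro i hw
        have ha := step2 i hw
        by_cases hb : eb i ∈ s
        · exact ((eff i).1 ha hb).1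
        · exact ((eff i).2.1 ha hb hw).1
      have thrI : ∀ j, ea j ∈ s → eb j ∈ s → (ea j ∈ s' ∧ eb j ∈ s') := fun j ha hb => (eff j).1 ha hb
      have thrI' : ∀ j, ea j ∈ s' → eb j ∈ s' → (ea j ∈ s ∧ eb j ∈ s) := by
        intro j ha' hb'
        by_cases ha : ea j ∈ s
        · by_cases hb : eb j ∈ s
          · exact ⟨ha, hb⟩
          · by_cases hw : lf j ∈ W
            · exact absurd hb' ((eff j).2.1 ha hb hw).2
            · exact absurd ha' ((eff j).2.2.1 ha hb hw).1
        · exact absurd hb' ((eff j).2.2.2 ha ((step1 j).resolve_left ha)).2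
      have eff' := psiEff s' step1' step2'
      -- (a) ψ s in the event
      have hEv' : ∀ w ∈ W, ¬ (w ∈ K s' ∧ w ∈ K (E \ s')) := by
        intro w hw hwKB
        obtain ⟨hwK, hwB⟩ := hwKB
        rcases hcases _ hs'E w hwK with hw1 | hw2 | ⟨i, hw3⟩
        · exact hxW (hw1 ▸ hw)
        · rw [hw2] at hwB
          obtain ⟨j, hja, hjb⟩ := (Bpole s' hs'E hes').mp hwB
          exact (step1' j).elim hja hjb
        · rw [hw3] at hw hwB
          rcases (Bleaf s' hs'E hes' i).mp hwB with hna | ⟨_, j, hja, hjb⟩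
          · exact hna (step2' i hw)
          · exact (step1' j).elim hja hjb
      -- (b1) Φ(ψ s) is outside the event (same witness)
      have hnA' : ¬ (∀ w ∈ W, ¬ (w ∈ K (insert e (E \ s')) ∧ w ∈ K (E \ insert e (E \ s')))) := by
        intro hcon
        rw [hPhi_compl s' hs'E] at hcon
        rcases wit with ⟨hhW, j, hja, hjb⟩ | ⟨i, hiW, hia, hib⟩
        · obtain ⟨hja', hjb'⟩ := thrI j hja hjb
          exact hcon h hhW ⟨Kpole _ (hPhi_sub s') (Finset.mem_insert_self _ _), (PhiBpole s' hs'E).mpr ⟨j, hja', hjb'⟩⟩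
        · obtain ⟨hia', hib'⟩ := (eff i).2.1 hia hib hiW
          exact hcon (lf i) hiW ⟨(PhiKleaf s' hs'E i).mpr (Or.inr hib'), (PhiBleaf s' hs'E i).mpr (Or.inl hia')⟩
      -- (b2) ψ (ψ s) = s
      have hinv : bookPsi lf ea eb e W s' = s := by
        ext j
        constructor
        · intro hj
          rcases (hE j).mp (hpsi_sub s' hj) with hje | ⟨i, hji⟩ | ⟨i, hji⟩
          · rw [hje]; exact hes
          · rw [hji] at hj ⊢
            by_contra ha
            have hb : eb i ∈ s := (step1 i).resolve_left ha
            obtain ⟨ha', hb'⟩ := (eff i).2.2.2 ha hb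
            have hw : lf i ∉ W := fun hw => ha (step2 i hw)
            exact ((eff' i).2.2.1 ha' hb' hw).1 hj
          · rw [hji] at hj ⊢
            by_contra hb
            rcases step1 i with ha | hb2
            · by_cases hw : lf i ∈ W
              · obtain ⟨ha', hb'⟩ := (eff i).2.1 ha hb hw
                exact ((eff' i).2.1 ha' hb' hw).2 hj
              · obtain ⟨ha', hb'⟩ := (eff i).2.2.1 ha hb hw
                exact ((eff' i).2.2.2 ha' hb').2 hj
            · exact hb hb2
        · intro hj
          rcases (hE j).mp (hs hj) with hje | ⟨i, hji⟩ | ⟨i, hji⟩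
          · rw [hje]; exact (hpsi s').1
          · rw [hji] at hj ⊢
            by_cases hb : eb i ∈ s
            · obtain ⟨ha', hb'⟩ := (eff i).1 hj hb
              exact ((eff' i).1 ha' hb').1
            · by_cases hw : lf i ∈ W
              · obtain ⟨ha', hb'⟩ := (eff i).2.1 hj hb hw
                exact ((eff' i).2.1 ha' hb' hw).1
              · obtain ⟨ha', hb'⟩ := (eff i).2.2.1 hj hb hw
                exact ((eff' i).2.2.2 ha' hb').1
          · rw [hji] at hj ⊢
            by_cases ha : ea i ∈ s
            · obtain ⟨ha', hb'⟩ := (eff i).1 ha hj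
              exact ((eff' i).1 ha' hb').2
            · obtain ⟨ha', hb'⟩ := (eff i).2.2.2 ha hj
              have hw : lf i ∉ W := fun hw => ha (step2 i hw)
              exact ((eff' i).2.2.1 ha' hb' hw).2
      refine ⟨?_, ?_, ?_⟩
      · rw [hPms, hmemF]; exact ⟨hs'E, hes', hEv'⟩
      · rw [hPms]
        show Pm s' = s
        simp only [hPm, if_neg hnA']
        exact hinv
      · -- (c) domination
        rw [hPms]
        intro v hv
        rcases hcases (E \ s) Finset.sdiff_subset v hv with hv1 | hv2 | ⟨i, hv3⟩
        · rw [hv1]; exact mem_openCluster_self _ _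
        · rw [hv2] at hv ⊢
          obtain ⟨j, hja, hjb⟩ := (Bpole s hs hes).mp hv
          exact ((step1 j).elim hja hjb).elim
        · rw [hv3] at hv ⊢
          rcases (Bleaf s hs hes i).mp hv with hna | ⟨_, j, hja, hjb⟩
          · have hb : eb i ∈ s := (step1 i).resolve_left hna
            exact (Kleaf s' hs'E hes' i).mpr (Or.inl ((eff i).2.2.2 hna hb).1)
          · exact ((step1 j).elim hja hjb).elim
  -- the sum: reindex `Σ g(K s)` through `Pm`
  have hsumK : ∑ s ∈ F, g (K s) = ∑ s ∈ F, g (K (Pm s)) := by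
    refine (Finset.sum_bij' (fun s _ => Pm s) (fun s _ => Pm s) ?_ ?_ ?_ ?_ ?_).symm
    · intro s hs; exact (hPm_props s hs).1
    · intro s hs; exact (hPm_props s hs).1
    · intro s hs; exact (hPm_props s hs).2.1
    · intro s hs; exact (hPm_props s hs).2.1
    · intro s hs; rfl
  rw [Finset.sum_sub_distrib, hsumK, ← Finset.sum_sub_distrib]
  exact Finset.sum_nonneg fun s hs => sub_nonneg.mpr (hg ((hPm_props s hs).2.2))

end Book

end Coefficientwise

end Summit.CriticalPhenomena.PercolationContinuityZ3.Theorems
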